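import Literature.MathematicalPhysics.QuantumFieldTheory.Balaban1983to89.T4BetaMemorySharp

/-!
# `Balaban1983to89.T4FlagMemory` — NE4 (node U2 of the T⁴ uniqueness spine) by a discrete-Grönwall / fading-memory
recursion on a GROWING FLAG: the renewal SHAPES of `T4BetaMemory` DERIVED (kernel) from an iterated one-step map, and
node U2's three inputs `ScaleShiftRate`, `HistLipschitz`, `FadingMemory` concluded for ANY β-family generated that way,
with the sharp rate `(1 + C′)ω` and explicit constants.  HYPOTHESIS SHAPES + BOOKKEEPING; nothing about Bałaban's
objects is asserted.

HONEST FRAMING (cell `pub-balaban`, T4-DAG PAGE 1).  The cell's T4 target is rung (B)+1 — existence AND uniqueness of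
the ε → 0 limit of Bałaban's unit-scale averaged expectations on a FIXED finite torus; NOT infinite volume, NOT a mass
gap, NOT the Clay problem.  This module belongs to spine estimate NE4 ("η-rate of the full β_k", node U2): the tree
types NE4 as `T4CouplingMatching.ScaleShiftRate` (split by `scaleShiftRate_of_split` into the β sub-cell's (AF-0r) and
`RemainderShiftRate` for the remainder β¹) together with history moduli `HistLipschitz Λ γ β` having `FadingMemory`;
`T4BetaMemory` (row T4-U2.R) reduces these to the structural shapes `DataRenewal` / `ShiftDecomposition` /
`ModuliRenewal` / `ModuliDecomposition` over ABSTRACT real sequences, and `T4BetaMemorySharp` shows the rate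
`(1 + C′)ω` of that renewal is attained.  What was not in the kernel (cell records `t4/T4-EST-U2R.md` §1.4 (α)(β)(γ),
`t4/T4-XREAD-U2R2.md` §3, `t4/T4-RUNG-U2R2.md` §7 (7.3)(5), GAPS G-t4-U2R-1…-4, G-b12g8-1, G-b12g8-2, G-t4-U2R2-6, G-t4-U2R2-6a): that
those abstract shapes ARE what an iterated one-step map produces — the index bookkeeping "g_i enters the entry born at
j > i only through the entries born in [i, j)", "run B's step k + 1 against run A's step k = one-step source + memory of
the older discrepancies" — and the threshold arithmetic in print's currency (corrected once by hand, G-t4-U2R2-6a).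
This module kernels exactly that, for an ARBITRARY family of one-step maps on an arbitrary (pseudo-)metric space of
"entries" (§1–§3), records the threshold arithmetic (§4), and exhibits a linear witness family in which every
hypothesis holds with genuinely non-zero memory and the one-step source of the scale shift is PRECISELY "the unpartnered
oldest entry weighted by its age" (§5).  VALUE = kernel reduction of NE4 to FOUR named one-step inputs (below) +
located threshold; NOT an estimate on Bałaban's (2.13), NOT summit progress.

WHAT PRINT SAYS (read by THIS seat as images on the ×2 journal-page renders
`b2b-balaban-ref1/pages/1987-cmp109-rg-I-small-field/…-p008-x2.png` (p. 256), `…-p016-x2.png` (p. 264), `…-p020-x2.png`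
(p. 268) and `…/1988-cmp119-convergent-renormalization/…-p020-x2.png` (p. 262); the manuscripts are UNDER ADJUDICATION
and are quoted for what they STATE, never as establishing a disputed step):
* [Balaban1987RG1] p. 256: (0.20) *"1/g_k² = 1/g²_{k+1} + β_{k+1}(g_k)"*; after (0.22): *"The function E_k depends also
  on the effective coupling constants g₀, …, g_{k−1}. It is a sum of contributions coming from the k successive
  integrations in the k renormalization transformations. … In the second step a new expression of this type is created,
  in the old only a background field is changed. Thus we obtain after k steps E_k(U_k) = Σ_{j=1}^{k} [−β_j(g_{j−1})
  A^η(U_k) + E^{(j)}(U_k)]. (0.23)"* — THE GROWING FLAG: one new entry per step, old entries never rewritten.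
* [Balaban1987RG1] p. 268: the new action (2.12) — every explicit term carries `g_kCB`, and the last term is the curly
  bracket *"{E_k(U_k(exp i[g_kCB − hD̃(g_kCB)]V^{(k)})) − E_k(U_k(V^{(k)}))}"* —, *"The integral in (2.12) defines the new
  term E^{(k+1)} in the inductive definition of the action A_{k+1} by the formula E^{(k+1)}(g_k, U_{k+1}) = log ∫
  dμ_{C^{(k)}}(B)χ_k exp[P^{(k)}(g_k, U_{k+1}, B) + {…}]. (2.13)"*, *"Let us remark that the expression under the
  exponential above vanishes at g_k = 0"*, and (2.15) *"with the β-function defined by the formulas (1.20), (1.22) for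
  j = k"*.  STRUCTURAL READING used below ([analysis] of the displayed formula, as in `T4BetaMemory`): the new entry is
  a function of (g_k; the previous flag E_k = the list of older entries); g₀, …, g_{k−1} enter ONLY through the older
  entries.  This is the ONE-STEP MAP `Φ k : ℝ → (ℕ → X) → X` of §1.
* [Balaban1987RG1] p. 264: β_{j+1}(g_j) is read off the new entry by the FIXED recipe (1.20)–(1.22) (second moment of the
  vacuum polarization tensor of E^{(j+1)}, after *"we take a limit of these functions as T^{(j+1)} ↗ Z^d"*), and *"It is a
  smooth function defined on the interval [0, γ], (or analytic), uniformly bounded on this interval together with all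
  derivatives. We will investigate other properties in a separate paper."* — the READ-OUT `r : X → ℝ` of §1 and the
  printed qualitative form of the direct modulus `StepDirect`.
* [Balaban1988Convergent] p. 262: *"All the inductive assumptions are formulated for the effective density obtained after
  the k-th operation RT. … the expressions with indices j < k are exactly as described above, but the newly created
  expressions E^{(k)}, R^{(k)}, B^{(k)} are defined on slightly larger spaces …"* and, after Theorem 1 (*"if the sequence
  of coupling constants {g_k}, determined by the recursive renormalization group (Callan-Symanzik) equations (0.18),
  (0.20) [I], satisfies the inequalities (I.0.33), then the sequence of densities {ρ_k}, generated by successive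
  applications of the operations RT to the density ρ₀ = exp[−(1/g₀²)A − E], satisfies all the inductive assumptions"*):
  *"For a given index k we introduce the space of all densities satisfying the conditions of the inductive assumption.
  The theorem states that the operation RT transforms the space with the index k into the space with the index k + 1.
  This generalization does not seem to be useful, or interesting now."* — the MAP-BETWEEN-SPACES formulation in which a
  modulus of continuity of one step would be stated is named by the author and set aside; print has SIZE bounds of the
  new entry ([Balaban1988Convergent] (2.43) p. 263; [II] = [Balaban1988RG2Cluster] Lemma 1 (1.33)–(1.36) p. 9, Lemma 3
  (2.38) p. 20, (2.41) p. 21 — these [II]/[III]-p. 263 loci per the cell's cross-reads `t4/T4-XREAD-U2.md`,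
  `t4/T4-XREAD-U2R2.md` (Q10)–(Q21), NOT re-read by this seat), never a MODULUS.
NOT PRINTED anywhere in [I]–[III] (cell cross-reads `t4/T4-XREAD-U2.md` §3, `t4/T4-XREAD-U2R2.md` N1/N2, `t4/T4-RUNG-U2R2.md`
§7 L8; GAPS G-t4-U2-1, G-t4-U2-2, G-b12g6-1, G-b12g8-1, G-b12g8-2): any Lipschitz MODULUS of the one-step map in the old entries
(`StepMemory`), any quantitative modulus in the coupling uniform in the step (`StepDirect` with one ℓ′), any comparison
of the step-(k+1) map with the step-k map (`StepShift`: the η = L^{−k}-dependence of the one-step objects — covariances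
and propagators C^{(k)}, G_k, H₁ of (2.12), minimisers U_{k+1}; cell NE2/NE3/NE5), any quantitative Lipschitz constant of
the read-out (`ReadLipschitz`).  These FOUR are the hypotheses of every theorem of §3; each is a `def … : Prop` consumed
as a hypothesis, none is asserted.

## What is typed and proved

(§1) THE GROWING FLAG (definitions).  Entries live in a pseudo-metric space `X`; a SCHEME is a family of one-step maps
`Φ : ℕ → ℝ → (ℕ → X) → X` (step j: coupling g_j and the flag of older entries ↦ the entry born at step j) and a
read-out `r : X → ℝ`.  Along a coupling sequence `g : ℕ → ℝ` the flag `flag Φ g j` (entries born before step j, junk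
`default` elsewhere) and the entries `entry Φ g j = Φ j (g j) (flag Φ g j)` are defined by primitive recursion
(`flag_apply`: `flag Φ g j m = if m < j then entry Φ g m else default` — old entries are never rewritten, (0.23)).
`Represents Φ r γ β`: on the boxes ]0,γ]^{k+1}, `β k v = r (entry Φ (extd v) k)` (`extd` extends a finite history to a
sequence by clamping; `extd_tail` is the index bookkeeping "run A's couplings = `Fin.tail` of run B's").

(§2) THE FOUR ONE-STEP HYPOTHESIS SHAPES.  `StepDirect Φ ℓ′ γ` (direct modulus in the own coupling), `StepMemory Φ M′`
(functional memory: modulus `M′ j m` of the step-j map in the entry born at m < j), `T4CouplingMatching.FadingMemory C′ ω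
M′` (tree shape: `M′ j m ≤ C′ω^{j−m}`), `StepShift Φ γ src` (run B's entry born at step k + 1 against what the STEP-k map
produces from run B's own shifted flag at the same coupling: the one-step source), `ReadLipschitz r cr`.

(§3) KERNEL THEOREMS.  `row_le`: the geometric profile `ν^{j−i}`, `ν = (1 + C′)ω`, is a supersolution of the moduli
renewal (`Σ_{m∈[i,j)} M′_{j,m} ν^{m−i} ≤ ν^{j−i}`, no smallness).  `dist_entry_le` (TWO-HISTORY MODULUS, strong induction
+ `Finset.sum_Ico_Ico_comm`): `dist (entry g j) (entry g′ j) ≤ Σ_{i≤j} ℓ′ν^{j−i}|g_i − g′_i|` for coupling sequences in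
]0,γ].  Hence `histLipschitz_of_scheme`: `HistLipschitz (fun k i ↦ cr·ℓ′·ν^{k−i}) γ β` and `fadingMemory_profile`:
`FadingMemory (cr ℓ′) ν (fun k i ↦ cr·ℓ′·ν^{k−i})` — bridge (b) of `T4BetaMemory` with ITS hypotheses `ModuliDecomposition`
/ `ModuliRenewal` no longer assumed but produced by the iteration, at the SHARP rate of `T4BetaMemorySharp`.
`dataRenewal_sh`: the shifted-run discrepancy `sh Φ g k = dist (entry g (k+1)) (entry (g ∘ succ) k)` satisfies
`T4BetaMemory.DataRenewal src M′ (sh Φ g)` LITERALLY (triangle inequality through the step-k map applied to run B's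
shifted flag) — bridge (a)'s hypothesis derived; `scaleShiftRate_of_scheme`: with `src k ≤ aρ^k` and the smallness
`(1 + C′)ω < ρ`, `ScaleShiftRate (cr·a(ρ−ω)(ρ−(1+C′)ω)⁻¹) ρ γ β` (via `T4BetaMemory.renewal_geometric`); `ne4_of_scheme`
packages the three node-U2 inputs with ONE rate ρ, and `injectedRate_of_scheme` composes them with
`T4CouplingMatching.injectedRate_of_runs_eventual` (the spine's consumer) — so that, for a β-family generated by such a
scheme, node U2's output `T4CauchySum.InjectedRate` rests on: the four one-step inputs, the printed recursion (0.20) for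
the runs, the IR pinning (node H3), an eventual lower bound `b ≤ β` (β sub-cell), and the smallness
`cr ℓ′((k₀+1)γ³ + 2γ/b) ≤ (1 − ρ)/2`.  `remainderShiftRate_iff`: the β¹-half `RemainderShiftRate S` is `ScaleShiftRate`
for the family `S.β1` (definitional), so everything applies verbatim to a scheme generating the remainder, and
`ne4_of_split_scheme` is NE4 in the cell's split form: β⁰-half `|β⁰_{k+1} − β_∞| ≤ c₀ρ^k` ((AF-0r), β sub-cell,
hypothesis) + β¹-half from a scheme representing `S.β1` ⇒ the three node-U2 inputs for the FULL β with
`c = 2c₀ + cr·a(ρ−ω)(ρ−(1+C′)ω)⁻¹` (via `T4CouplingMatching.scaleShiftRate_of_split`).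

(§4) THE THRESHOLD IN PRINT'S CURRENCY ([analysis] on located formulas; cell `t4/T4-XREAD-U2R2.md` §3(i)–(ii) and
`t4/T4-RUNG-U2R2.md` (7.3)(5) as corrected by GAPS G-t4-U2R2-6a).  The activity-level age weight of [II] is `L^{jη}` per
old entry, i.e. in `FadingMemory C′ ω M′`'s convention (new index j, most recent old entry weighted `C′ω`) `ω = L⁻¹` and
`C′ = L·κ`, `κ` = the one-hop transfer constant of the most recent old entry (print's type: `κ = c′K₁ε₁`, `K₁` assembled
from printed size constants, `c′` an UNPRINTED absolute factor, G-b12g8-1, G-b12g8-2).  Then the sharp rate is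
`(1 + C′)ω = L⁻¹ + κ` (`sharpRate_currency`), the smallness `(1 + C′)ω < ρ` reads `κ < ρ − L⁻¹` (`hsmall_currency`) — a
window condition on ε₁ of printed TYPE, never "L large" (L is fixed before ε₁ in [II]) —, and print's own window
`K₁ε₁ ≤ ½` ([II] p. 21 «O(1)C₃ε₁ ≤ ½E₀», cross-read (Q21)) yields a rate `< 1` for every admissible ε₁ iff
`c′ < 2(1 − L⁻¹)` (`window_currency`).  Nothing printed fixes `c′`; this is the LOCATED missing number of NE4 on the memory side
(the other being the one-step source rate `src k ≤ aρ^k`, cell NE2/NE3/NE5).  By `T4BetaMemorySharp.not_fadingMemory_below`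
no rate below `(1 + C′)ω` follows from these shapes, so the threshold is intrinsic to the method, not to this proof.

(§5) WITNESS (non-vacuity with non-zero memory; [folklore]).  On `X = ℝ` the linear scheme
`linStep ℓ′ C′ ω j g y = ℓ′g + Σ_{m<j} C′ω^{j−m} y_m` satisfies `StepDirect` (ℓ′), `StepMemory` with `M′ j m = C′ω^{j−m}`,
`FadingMemory C′ ω M′`, and `StepShift` with source EXACTLY `C′ω^{k+1}·|entry 0|` ≤ `(C′ℓ′γω)·ω^k` — the unpartnered
oldest entry of run B weighted by its age, and nothing else (`linStep_shift_eq`); its history sensitivities are the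
extremal moduli `T4BetaMemorySharp.lamE` (remark; not re-proved), so the profile rate `(1 + C′)ω` of §3 is attained in
this family.

(§6) WHERE (M) SPLITS (v1.1; the located structure of the missing modulus).  If the step-j map FACTORS through a space
of ACTIVITIES, `Φ j g y = val j g (act j g y)` (`factorStep`), with (lin) `ActInsertion act κA ω` — the activities
depend on the entry born at m with modulus `κA·ω^{j−m}` (PRINTED STRUCTURE at the activity level of [II]: the old terms
enter the fluctuation activities LINEARLY, (1.33) p. 9, with one surviving age factor `L^{jη}` per old scale, (1.24)/(1.36)
pp. 8–9 — cell cross-read `t4/T4-XREAD-U2R2.md` (Q10)–(Q13), certificate C-b12g8-1; the constant κA is printed-TYPE only)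
— and (val) `ActToValue val KV` — the VALUE of the expansion is Lipschitz in the activities (NOT PRINTED in [II], which
bounds one family, (2.41); KERNEL IN KIND in the tree for Kotecký–Preiss polymer gases in B13's printed letters:
`T4ActivityLipschitz.norm_locE_sub_locE_le` (cell NE5 prover P2, p184343) gives `|E_A(X) − E_B(X)| ≤ 4ε·τc₁K₀e^{−b}e^{−r₁d(X)}`
for activity families within relative distance ε of each other under the DOUBLED (2.38)-majorant window — cited BY
NAME, not imported) — then `StepMemory Φ (fun j m ↦ KV·κA·ω^{j−m})` and `FadingMemory (KV·κA) ω _`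
(`stepMemory_of_factor`, `fadingMemory_of_factor`): the memory constant of §4 is `C′ = KV·κA`, i.e. in print's currency
`κ = C′ω = KV·κA·L⁻¹` with `KV = 4 × (the (2.41)-envelope constant at the doubled window)` and κA the activity-insertion
constant — every factor now has a named source; none is a printed NUMBER.

Deliberately NOT here: any instance of the four hypotheses for Bałaban's (2.13) (not printed; the cell's NE2/NE3/NE5/NE9
and the constant c′ above); the β⁰/(AF-0r) half (β sub-cell); large-field entries R^{(k)}, B^{(k)} of [III] (they would
be further coordinates of the same flag — the shapes are blind to what an entry is).  Imports `T4BetaMemorySharp` (hence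
`T4BetaMemory`, `T4CouplingMatching`, `FlowStep`, `B12Beta`, `T4CauchySum`) and modifies nothing; Mathlib otherwise; no
`sorry`, no `axiom`.  Unit `b2b-balaban-t4-ne4-p1` (PROVER P1 for NE4, technique "discrete-Grönwall / fading-memory
recursion"; journal claim T4-U2.NE4-PROVE-P1, CLAIMS.log 2026-08-19); companion record `t4/T4-EST-NE4-P1.md`.

CITATION HEADER (lean-in-tree rule 2026-08-18).  T. Bałaban, *Renormalization group approach to lattice gauge field
theories. I*, Commun. Math. Phys. **109** (1987) 249–301 [Balaban1987RG1] (cell paper B12 = [I]; journal page = PDF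
page + 248); T. Bałaban, *Renormalization group approach to lattice gauge field theories. II*, Commun. Math. Phys.
**116** (1988) 1–22 [Balaban1988RG2Cluster] ([II]); T. Bałaban, *Convergent renormalization expansions for lattice
gauge theories*, Commun. Math. Phys. **119** (1988) 243–285 [Balaban1988Convergent] (B14 = [III]; journal page = PDF
page + 242).  Printed TEMPLATE of a geometric scale rate in a sibling model (shape only): C. King, Commun. Math. Phys.
**102** (1986) 649–677, Thm 3.4 (3.9) p. 656 [King1986].
-/

namespace Literature.MathematicalPhysics.QuantumFieldTheory.Balaban1983to89.T4FlagMemory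

open Literature.MathematicalPhysics.QuantumFieldTheory.Balaban1983to89
open Literature.MathematicalPhysics.QuantumFieldTheory.Balaban1983to89.FlowStep
open Literature.MathematicalPhysics.QuantumFieldTheory.Balaban1983to89.T4CouplingMatching
  (ScaleShiftRate RemainderShiftRate HistLipschitz FadingMemory EventualLowerH disc)
open Literature.MathematicalPhysics.QuantumFieldTheory.Balaban1983to89.T4BetaMemory (DataRenewal)
open Finset

/-! ## §1 The growing flag generated by a family of one-step maps (definitions, index bookkeeping) -/

section Flag

variable {X : Type*} [Inhabited X]

/-- The FLAG of entries born before step `j` along the coupling sequence `g` (junk `default` at positions `≥ j`),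
by primitive recursion: at step `j` ONE new entry `Φ j (g j) (flag Φ g j)` is appended and the old ones are kept
([Balaban1987RG1] (0.23) p. 256: "a new expression of this type is created, in the old only a background field is
changed").  MODEL of the bookkeeping only. [cite: Balaban1987RG1, (0.23) p.256] -/
def flag (Φ : ℕ → ℝ → (ℕ → X) → X) (g : ℕ → ℝ) : ℕ → ℕ → X
  | 0 => fun _ => default
  | j + 1 => fun m => if m = j then Φ j (g j) (flag Φ g j) else flag Φ g j m

/-- The entry born at step `j`: the one-step map applied to the coupling `g j` and the flag of older entries — the
structural reading of [Balaban1987RG1] (2.13) p. 268 (the new term is a function of `g_k` and, through the curly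
bracket of (2.12), of the previous action `E_k` = the older entries). [cite: Balaban1987RG1, (2.13) p.268] -/
def entry (Φ : ℕ → ℝ → (ℕ → X) → X) (g : ℕ → ℝ) (j : ℕ) : X := Φ j (g j) (flag Φ g j)

/-- Unfolding of `entry`. [folklore] -/
theorem entry_def (Φ : ℕ → ℝ → (ℕ → X) → X) (g : ℕ → ℝ) (j : ℕ) :
    entry Φ g j = Φ j (g j) (flag Φ g j) := rfl

/-- OLD ENTRIES ARE NEVER REWRITTEN: the flag before step `j` lists exactly the entries born at the steps `m < j`.
[folklore] -/
theorem flag_apply (Φ : ℕ → ℝ → (ℕ → X) → X) (g : ℕ → ℝ) :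
    ∀ j m, flag Φ g j m = if m < j then entry Φ g m else default := by
  intro j
  induction j with
  | zero => intro m; simp [flag]
  | succ j ih =>
      intro m
      simp only [flag]
      by_cases hm : m = j
      · subst hm
        simp [entry_def]
      · rw [if_neg hm, ih m]
        by_cases hmj : m < j
        · rw [if_pos hmj, if_pos (by omega)]
        · rw [if_neg hmj, if_neg (by omega)]

/-- Extension of a finite history `v = (g_0, …, g_k)` to a sequence by clamping (`g_m := g_k` for `m > k`); only the
prefix is ever used, the clamping keeps the extension inside the box. [folklore] -/
def extd {k : ℕ} (v : Fin (k + 1) → ℝ) : ℕ → ℝ :=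
  fun m => if h : m ≤ k then v ⟨m, Nat.lt_succ_of_le h⟩ else v (Fin.last k)

/-- On the prefix the extension is the history. [folklore] -/
@[simp] theorem extd_coe {k : ℕ} (v : Fin (k + 1) → ℝ) (i : Fin (k + 1)) : extd v i = v i := by
  have hi : (i : ℕ) ≤ k := Nat.le_of_lt_succ i.isLt
  simp [extd, hi]

/-- ADMISSIBLE coupling sequences: every coupling in ]0, γ] (the hypothesis `0 < g_k ≤ γ` of [Balaban1987RG1] Thm 3
p. 264, for all k). [cite: Balaban1987RG1, Thm 3 p.264] -/
def Adm (γ : ℝ) (g : ℕ → ℝ) : Prop := ∀ m, 0 < g m ∧ g m ≤ γ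

/-- A history in the box extends to an admissible sequence. [folklore] -/
theorem extd_adm {γ : ℝ} {k : ℕ} {v : Fin (k + 1) → ℝ} (hv : v ∈ Box γ k) : Adm γ (extd v) := by
  intro m
  unfold extd
  split_ifs with h
  · exact (mem_box.mp hv) _
  · exact (mem_box.mp hv) _

/-- INDEX BOOKKEEPING OF THE TWO RUNS: run A's couplings `Fin.tail w` (the finest coupling `w 0` dropped) extend to the
SHIFT of run B's extended couplings. [folklore] -/
theorem extd_tail {k : ℕ} (w : Fin (k + 2) → ℝ) : extd (Fin.tail w) = fun m => extd w (m + 1) := by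
  funext m
  unfold extd
  by_cases h : m ≤ k
  · have h' : m + 1 ≤ k + 1 := by omega
    rw [dif_pos h, dif_pos h']
    rfl
  · have h' : ¬ m + 1 ≤ k + 1 := by omega
    rw [dif_neg h, dif_neg h']
    rfl

/-- `Fin.tail` keeps a history in the box. [folklore] -/
theorem tail_mem_box {γ : ℝ} {k : ℕ} {w : Fin (k + 2) → ℝ} (hw : w ∈ Box γ (k + 1)) :
    Fin.tail w ∈ Box γ k :=
  mem_box.mpr fun i => (mem_box.mp hw) i.succ

/-- REPRESENTATION HYPOTHESIS: the β-family is READ OFF the newest entry of the flag by a fixed read-out `r`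
([Balaban1987RG1] (1.20)–(1.22) p. 264: β_{j+1} = second moment of the vacuum polarization tensor of E^{(j+1)}, a fixed
recipe; (2.15) p. 268 "with the β-function defined by the formulas (1.20), (1.22) for j = k") along the entries generated
by the one-step maps `Φ` from the history: `β k v = r (entry Φ (extd v) k)` on ]0,γ]^{k+1}.  A MODELLING hypothesis
(which `X`, `Φ`, `r` realise (2.13) is not decided here). [cite: Balaban1987RG1, (1.22) p.264 and (2.15) p.268] -/
def Represents (Φ : ℕ → ℝ → (ℕ → X) → X) (r : X → ℝ) (γ : ℝ) (β : HBeta) : Prop :=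
  ∀ k (v : Fin (k + 1) → ℝ), v ∈ Box γ k → β k v = r (entry Φ (extd v) k)

end Flag

/-! ## §2 The four one-step hypothesis shapes (NOT PRINTED; consumed as hypotheses only) -/

section Shapes

variable {X : Type*} [PseudoMetricSpace X] [Inhabited X]

/-- HYPOTHESIS SHAPE (NOT PRINTED as a quantitative statement): DIRECT MODULUS of the step-j map in its OWN coupling,
uniformly in the step and in the older entries: `dist (Φ j g y) (Φ j g′ y) ≤ ℓ′|g − g′|` for `g, g′ ∈ ]0,γ]`.  Printed
qualitative form: [Balaban1987RG1] p. 264 "smooth … (or analytic), uniformly bounded on this interval together with all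
derivatives" (of β_{j+1} in g_j, per j; uniformity in j UNPRINTED, GAPS G-b12-2); every term of (2.12) p. 268 carries
`g_kCB`.  The diagonal datum `ℓ′` of `T4BetaMemory.ModuliRenewal`. [cite: Balaban1987RG1, §1 p.264 and (2.12) p.268] -/
def StepDirect (Φ : ℕ → ℝ → (ℕ → X) → X) (ℓ' γ : ℝ) : Prop :=
  ∀ j (g g' : ℝ) (y : ℕ → X), 0 < g → g ≤ γ → 0 < g' → g' ≤ γ → dist (Φ j g y) (Φ j g' y) ≤ ℓ' * |g - g'|

/-- HYPOTHESIS SHAPE (NOT PRINTED — the cell's located missing input, GAPS G-b12g6-1 / G-b12g8-1 / G-t4-U2R-1):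
FUNCTIONAL MEMORY of the step-j map — a Lipschitz MODULUS `M′ j m` of the new entry in the old entry born at `m < j`, at
fixed coupling: `dist (Φ j g y) (Φ j g y′) ≤ Σ_{m<j} M′_{j,m} dist (y m) (y′ m)`.  Print has SIZE bounds of the new entry
([Balaban1988Convergent] (2.43) p. 263; [Balaban1988RG2Cluster] Lemma 3 (2.38)–(2.41) pp. 20–21), not a modulus; the
map-between-spaces formulation is set aside on p. 262 of [Balaban1988Convergent]. [cite: Balaban1988Convergent, Thm 1 p.262 and (2.43) p.263] -/
def StepMemory (Φ : ℕ → ℝ → (ℕ → X) → X) (M' : ℕ → ℕ → ℝ) : Prop :=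
  ∀ j (g : ℝ) (y y' : ℕ → X), dist (Φ j g y) (Φ j g y') ≤ ∑ m ∈ range j, M' j m * dist (y m) (y' m)

/-- HYPOTHESIS SHAPE (NOT PRINTED — cell NE2/NE3/NE5): ONE-STEP SOURCE OF THE SCALE SHIFT.  Along an admissible coupling
sequence `g` (run B), the entry born at step `k + 1` differs from what the STEP-k map produces, at the SAME coupling
`g (k+1)`, from run B's own flag SHIFTED by one (oldest entry dropped, entry born at m + 1 put in position m) by at most
`src k`: the η = L^{−k}-dependence of the one-step objects of (2.12) (covariance C^{(k)}, propagators G_k, H₁, minimisers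
U_{k+1}; [Balaban1987RG1] p. 268) plus the influence of the unpartnered oldest entry, after transport of entries between
adjacent scales (all of which the model leaves inside `X`, `Φ`).  Print compares NO objects at two lattice spacings
(GAPS G-t4-U2-1). [cite: Balaban1987RG1, (2.12)-(2.13) p.268] -/
def StepShift (Φ : ℕ → ℝ → (ℕ → X) → X) (γ : ℝ) (src : ℕ → ℝ) : Prop :=
  ∀ g : ℕ → ℝ, Adm γ g → ∀ k,
    dist (entry Φ g (k + 1)) (Φ k (g (k + 1)) (fun m => if m < k then entry Φ g (m + 1) else default)) ≤ src k

/-- HYPOTHESIS SHAPE: the read-out is Lipschitz, `|r x − r x′| ≤ cr · dist x x′` (β is a LINEAR functional of the new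
entry — [Balaban1987RG1] (1.20)–(1.22) p. 264, (5.42) p. 297 — so in any norm controlling second field-derivatives this is
its operator norm; the constant is NOT PRINTED). [cite: Balaban1987RG1, (1.20)-(1.22) p.264] -/
def ReadLipschitz (r : X → ℝ) (cr : ℝ) : Prop := ∀ x x' : X, |r x - r x'| ≤ cr * dist x x'

/-- The SHIFTED-RUN DISCREPANCY: run B (couplings `g`, one more ultraviolet step) at step `k + 1` against run A
(couplings `g ∘ succ`, i.e. the finest one dropped) at step `k` — the quantity `s k` of `T4BetaMemory.DataRenewal`,
here DEFINED from the iteration. [folklore] -/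
noncomputable def sh (Φ : ℕ → ℝ → (ℕ → X) → X) (g : ℕ → ℝ) (k : ℕ) : ℝ :=
  dist (entry Φ g (k + 1)) (entry Φ (fun m => g (m + 1)) k)

end Shapes

/-! ## §3 Kernel theorems: two-history modulus, data renewal of the scale shift, node U2's three inputs -/

section Kernel

variable {X : Type*} [PseudoMetricSpace X] [Inhabited X]

/-- THE GEOMETRIC PROFILE IS A SUPERSOLUTION OF THE MODULI RENEWAL (no smallness): under `FadingMemory C′ ω M′`
(`C′, ω ≥ 0`), for `i < j`, `Σ_{m∈[i,j)} M′_{j,m} ν^{m−i} ≤ ν^{j−i}` with `ν = (1 + C′)ω`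
(indeed `≤ ν^{j−i} − ω^{j−i}`: `C′Σ_{n<N}(1 + C′)^n = (1 + C′)^N − 1`).  The computation of
`T4BetaMemorySharp.moduli_geometric_sharp`, in the form the induction below consumes. [folklore] -/
theorem row_le {M' : ℕ → ℕ → ℝ} {C' ω : ℝ} (hC' : 0 ≤ C') (hω : 0 ≤ ω) (hM' : FadingMemory C' ω M')
    {i j : ℕ} (hij : i < j) :
    ∑ m ∈ Ico i j, M' j m * ((1 + C') * ω) ^ (m - i) ≤ ((1 + C') * ω) ^ (j - i) := by
  obtain ⟨N, rfl⟩ : ∃ N, j = i + N := ⟨j - i, by omega⟩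
  rw [Finset.sum_Ico_eq_sum_range, Nat.add_sub_cancel_left]
  have hν0 : 0 ≤ (1 + C') * ω := mul_nonneg (by linarith) hω
  have hstep : ∑ n ∈ range N, M' (i + N) (i + n) * ((1 + C') * ω) ^ (i + n - i)
      ≤ ∑ n ∈ range N, C' * ω ^ N * (1 + C') ^ n := by
    refine Finset.sum_le_sum fun n hn => ?_
    have hnN : n < N := mem_range.mp hn
    obtain ⟨_, hM1⟩ := hM' (i + N) (i + n) (by omega)
    rw [show i + N - (i + n) = N - n by omega] at hM1
    rw [Nat.add_sub_cancel_left]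
    calc M' (i + N) (i + n) * ((1 + C') * ω) ^ n ≤ C' * ω ^ (N - n) * ((1 + C') * ω) ^ n :=
          mul_le_mul_of_nonneg_right hM1 (pow_nonneg hν0 n)
      _ = C' * (ω ^ (N - n) * ω ^ n) * (1 + C') ^ n := by rw [mul_pow]; ring
      _ = C' * ω ^ N * (1 + C') ^ n := by rw [← pow_add, Nat.sub_add_cancel hnN.le]
  have hgeom : ∑ n ∈ range N, C' * ω ^ N * (1 + C') ^ n = ω ^ N * ((1 + C') ^ N - 1) := by
    rw [← Finset.mul_sum]
    have hg : C' * ∑ n ∈ range N, (1 + C') ^ n = (1 + C') ^ N - 1 := by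
      have h := geom_sum_mul (1 + C') N
      rw [mul_comm]
      simpa using h
    calc C' * ω ^ N * ∑ n ∈ range N, (1 + C') ^ n = ω ^ N * (C' * ∑ n ∈ range N, (1 + C') ^ n) := by ring
      _ = ω ^ N * ((1 + C') ^ N - 1) := by rw [hg]
  have hωN : 0 ≤ ω ^ N := pow_nonneg hω N
  calc ∑ n ∈ range N, M' (i + N) (i + n) * ((1 + C') * ω) ^ (i + n - i)
      ≤ ω ^ N * ((1 + C') ^ N - 1) := hstep.trans hgeom.le
    _ ≤ ω ^ N * (1 + C') ^ N := by nlinarith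
    _ = ((1 + C') * ω) ^ N := by rw [mul_pow]; ring

/-- **TWO-HISTORY MODULUS OF THE GENERATED ENTRIES (discrete Grönwall on the growing flag).**  Under `StepDirect Φ ℓ′ γ`,
`StepMemory Φ M′`, `FadingMemory C′ ω M′` (`ℓ′, C′, ω ≥ 0`), for admissible coupling sequences `g, g′`:
`dist (entry Φ g j) (entry Φ g′ j) ≤ Σ_{i≤j} ℓ′((1 + C′)ω)^{j−i}|g_i − g′_i|` for every `j` — the coupling `g_i`
influences the entry born at `j` with weight `ℓ′ν^{j−i}`, `ν = (1 + C′)ω`, NO smallness needed for the statement (whether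
`ν < 1` is the separate, located question of §4).  Strong induction on `j`: one triangle inequality through
`Φ j (g′ j) (flag Φ g j)`, the memory sum re-indexed by `Finset.sum_Ico_Ico_comm`, and `row_le`.  This is the content of
`T4BetaMemory.ModuliRenewal` + `moduli_geometric(_sharp)` PRODUCED by the iteration instead of assumed. [folklore] -/
theorem dist_entry_le {Φ : ℕ → ℝ → (ℕ → X) → X} {M' : ℕ → ℕ → ℝ} {ℓ' C' ω γ : ℝ} {g g' : ℕ → ℝ}
    (hℓ' : 0 ≤ ℓ') (hC' : 0 ≤ C') (hω : 0 ≤ ω)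
    (hdir : StepDirect Φ ℓ' γ) (hmem : StepMemory Φ M') (hM' : FadingMemory C' ω M')
    (hg : Adm γ g) (hg' : Adm γ g') :
    ∀ j, dist (entry Φ g j) (entry Φ g' j)
      ≤ ∑ i ∈ range (j + 1), ℓ' * ((1 + C') * ω) ^ (j - i) * |g i - g' i| := by
  intro j
  induction j using Nat.strong_induction_on with
  | _ j ih =>
    -- one step of the iteration: direct modulus + functional memory
    have h1 : dist (entry Φ g j) (entry Φ g' j)
        ≤ ℓ' * |g j - g' j| + ∑ m ∈ range j, M' j m * dist (entry Φ g m) (entry Φ g' m) := by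
      have hA := hdir j (g j) (g' j) (flag Φ g j) (hg j).1 (hg j).2 (hg' j).1 (hg' j).2
      have hB := hmem j (g' j) (flag Φ g j) (flag Φ g' j)
      have hB' : ∑ m ∈ range j, M' j m * dist (flag Φ g j m) (flag Φ g' j m)
          = ∑ m ∈ range j, M' j m * dist (entry Φ g m) (entry Φ g' m) := by
        refine Finset.sum_congr rfl fun m hm => ?_
        have hmj : m < j := mem_range.mp hm
        rw [flag_apply, flag_apply, if_pos hmj, if_pos hmj]
      rw [entry_def, entry_def]
      calc dist (Φ j (g j) (flag Φ g j)) (Φ j (g' j) (flag Φ g' j))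
          ≤ dist (Φ j (g j) (flag Φ g j)) (Φ j (g' j) (flag Φ g j))
            + dist (Φ j (g' j) (flag Φ g j)) (Φ j (g' j) (flag Φ g' j)) := dist_triangle _ _ _
        _ ≤ ℓ' * |g j - g' j| + ∑ m ∈ range j, M' j m * dist (entry Φ g m) (entry Φ g' m) := by
            rw [← hB']
            exact add_le_add hA hB
    -- the induction hypothesis inside the memory sum
    have h2 : ∑ m ∈ range j, M' j m * dist (entry Φ g m) (entry Φ g' m)
        ≤ ∑ m ∈ range j, M' j m * ∑ i ∈ range (m + 1), ℓ' * ((1 + C') * ω) ^ (m - i) * |g i - g' i| := by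
      refine Finset.sum_le_sum fun m hm => ?_
      have hmj : m < j := mem_range.mp hm
      exact mul_le_mul_of_nonneg_left (ih m hmj) (hM' j m hmj.le).1
    -- interchange of the two summations (i ≤ m < j)
    have h3 : ∑ i ∈ range j, (∑ m ∈ Ico i j, M' j m * ((1 + C') * ω) ^ (m - i)) * (ℓ' * |g i - g' i|)
        = ∑ m ∈ range j, M' j m * ∑ i ∈ range (m + 1), ℓ' * ((1 + C') * ω) ^ (m - i) * |g i - g' i| := by
      simp only [Finset.range_eq_Ico]
      calc ∑ i ∈ Ico 0 j, (∑ m ∈ Ico i j, M' j m * ((1 + C') * ω) ^ (m - i)) * (ℓ' * |g i - g' i|)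
          = ∑ i ∈ Ico 0 j, ∑ m ∈ Ico i j, M' j m * ((1 + C') * ω) ^ (m - i) * (ℓ' * |g i - g' i|) :=
            Finset.sum_congr rfl fun i _ => Finset.sum_mul _ _ _
        _ = ∑ m ∈ Ico 0 j, ∑ i ∈ Ico 0 (m + 1), M' j m * ((1 + C') * ω) ^ (m - i) * (ℓ' * |g i - g' i|) :=
            Finset.sum_Ico_Ico_comm 0 j _
        _ = ∑ m ∈ Ico 0 j, M' j m * ∑ i ∈ Ico 0 (m + 1), ℓ' * ((1 + C') * ω) ^ (m - i) * |g i - g' i| := by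
            refine Finset.sum_congr rfl fun m _ => ?_
            rw [Finset.mul_sum]
            exact Finset.sum_congr rfl fun i _ => by ring
    -- the geometric profile dominates each row
    have h4 : ∀ i ∈ range j,
        (∑ m ∈ Ico i j, M' j m * ((1 + C') * ω) ^ (m - i)) * (ℓ' * |g i - g' i|)
          ≤ ((1 + C') * ω) ^ (j - i) * (ℓ' * |g i - g' i|) := fun i hi =>
      mul_le_mul_of_nonneg_right (row_le hC' hω hM' (mem_range.mp hi)) (mul_nonneg hℓ' (abs_nonneg _))
    calc dist (entry Φ g j) (entry Φ g' j)
        ≤ ℓ' * |g j - g' j| + ∑ m ∈ range j, M' j m * dist (entry Φ g m) (entry Φ g' m) := h1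
      _ ≤ ℓ' * |g j - g' j|
          + ∑ i ∈ range j, (∑ m ∈ Ico i j, M' j m * ((1 + C') * ω) ^ (m - i)) * (ℓ' * |g i - g' i|) := by
          rw [h3]
          exact add_le_add le_rfl h2
      _ ≤ ℓ' * |g j - g' j| + ∑ i ∈ range j, ((1 + C') * ω) ^ (j - i) * (ℓ' * |g i - g' i|) :=
          add_le_add le_rfl (Finset.sum_le_sum h4)
      _ = ∑ i ∈ range (j + 1), ℓ' * ((1 + C') * ω) ^ (j - i) * |g i - g' i| := by
          rw [Finset.sum_range_succ, Nat.sub_self, pow_zero, mul_one, add_comm]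
          congr 1
          exact Finset.sum_congr rfl fun i _ => by ring

/-- **NODE U2's HISTORY MODULI FROM THE SCHEME (bridge (b) of `T4BetaMemory`, derived).**  If `β` is represented by the
scheme (`Represents Φ r γ β`) with `ReadLipschitz r cr` and the three one-step shapes, then
`T4CouplingMatching.HistLipschitz (fun k i ↦ cr·ℓ′·((1 + C′)ω)^{k−i}) γ β`.  Every hypothesis about the scheme is an
UNPRINTED input; the theorem is bookkeeping (`dist_entry_le`). [cite: Balaban1987RG1, §5 p.298 and §1 p.264] -/
theorem histLipschitz_of_scheme {Φ : ℕ → ℝ → (ℕ → X) → X} {r : X → ℝ} {β : HBeta} {M' : ℕ → ℕ → ℝ}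
    {ℓ' C' ω γ cr : ℝ} (hℓ' : 0 ≤ ℓ') (hC' : 0 ≤ C') (hω : 0 ≤ ω) (hcr : 0 ≤ cr)
    (hrep : Represents Φ r γ β) (hr : ReadLipschitz r cr)
    (hdir : StepDirect Φ ℓ' γ) (hmem : StepMemory Φ M') (hM' : FadingMemory C' ω M') :
    HistLipschitz (fun k i => cr * ℓ' * ((1 + C') * ω) ^ (k - i)) γ β := by
  intro k p q hp hq
  rw [hrep k p hp, hrep k q hq]
  have h := dist_entry_le hℓ' hC' hω hdir hmem hM' (extd_adm hp) (extd_adm hq) k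
  have e : ∑ i : Fin (k + 1), cr * ℓ' * ((1 + C') * ω) ^ (k - (i : ℕ)) * |p i - q i|
      = cr * ∑ i ∈ range (k + 1), ℓ' * ((1 + C') * ω) ^ (k - i) * |extd p i - extd q i| := by
    rw [Finset.mul_sum, ← Fin.sum_univ_eq_sum_range]
    refine Finset.sum_congr rfl fun i _ => ?_
    rw [extd_coe, extd_coe]
    ring
  calc |r (entry Φ (extd p) k) - r (entry Φ (extd q) k)|
      ≤ cr * dist (entry Φ (extd p) k) (entry Φ (extd q) k) := hr _ _
    _ ≤ cr * ∑ i ∈ range (k + 1), ℓ' * ((1 + C') * ω) ^ (k - i) * |extd p i - extd q i| :=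
        mul_le_mul_of_nonneg_left h hcr
    _ = ∑ i : Fin (k + 1), cr * ℓ' * ((1 + C') * ω) ^ (k - (i : ℕ)) * |p i - q i| := e.symm

/-- The geometric profile itself has `FadingMemory` with its own constant and rate (trivially, by equality) — so the
moduli delivered by `histLipschitz_of_scheme` satisfy `T4CouplingMatching.FadingMemory (cr ℓ′) ((1 + C′)ω)`; all the
content of "fading memory" has moved into the profile of `dist_entry_le`. [folklore] -/
theorem fadingMemory_profile {D ν : ℝ} (hD : 0 ≤ D) (hν : 0 ≤ ν) :
    FadingMemory D ν (fun k i => D * ν ^ (k - i)) := fun _ _ _ =>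
  ⟨mul_nonneg hD (pow_nonneg hν _), le_rfl⟩

/-- Rates can be worsened: `FadingMemory C ν Λ`, `0 ≤ ν ≤ ρ`, `0 ≤ C` ⇒ `FadingMemory C ρ Λ`. [folklore] -/
theorem fadingMemory_mono {C ν ρ : ℝ} {Λ : ℕ → ℕ → ℝ} (hC : 0 ≤ C) (hν : 0 ≤ ν) (hνρ : ν ≤ ρ)
    (h : FadingMemory C ν Λ) : FadingMemory C ρ Λ := fun k i hik =>
  ⟨(h k i hik).1, (h k i hik).2.trans (mul_le_mul_of_nonneg_left (pow_le_pow_left₀ hν hνρ _) hC)⟩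

/-- **THE SCALE SHIFT OBEYS `T4BetaMemory.DataRenewal` (bridge (a)'s hypothesis, derived).**  Under `StepMemory Φ M′`
with `M′ ≥ 0` below the diagonal and `StepShift Φ γ src`, along any admissible run-B coupling sequence `g`:
`sh Φ g k ≤ src k + Σ_{m<k} M′_{k,m} · sh Φ g m` — one triangle inequality through the step-k map applied, at run B's
coupling `g (k+1)` (= run A's k-th), to run B's shifted flag; the entry of run B born at m + 1 is partnered with the
entry of run A born at m. [folklore] -/
theorem dataRenewal_sh {Φ : ℕ → ℝ → (ℕ → X) → X} {M' : ℕ → ℕ → ℝ} {γ : ℝ} {src : ℕ → ℝ} {g : ℕ → ℝ}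
    (hmem : StepMemory Φ M') (hsh : StepShift Φ γ src) (hg : Adm γ g) :
    DataRenewal src M' (sh Φ g) := by
  intro k
  have h1 := hsh g hg k
  have h2 := hmem k (g (k + 1)) (fun m => if m < k then entry Φ g (m + 1) else default)
    (flag Φ (fun m => g (m + 1)) k)
  have h2' : ∑ m ∈ range k, M' k m *
        dist ((fun m => if m < k then entry Φ g (m + 1) else default) m) (flag Φ (fun m => g (m + 1)) k m)
      = ∑ m ∈ range k, M' k m * sh Φ g m := by
    refine Finset.sum_congr rfl fun m hm => ?_
    have hmk : m < k := mem_range.mp hm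
    simp only [sh]
    rw [if_pos hmk, flag_apply, if_pos hmk]
  rw [h2'] at h2
  unfold sh
  calc dist (entry Φ g (k + 1)) (entry Φ (fun m => g (m + 1)) k)
      ≤ dist (entry Φ g (k + 1)) (Φ k (g (k + 1)) (fun m => if m < k then entry Φ g (m + 1) else default))
        + dist (Φ k (g (k + 1)) (fun m => if m < k then entry Φ g (m + 1) else default))
            (entry Φ (fun m => g (m + 1)) k) := dist_triangle _ _ _
    _ ≤ src k + ∑ m ∈ range k, M' k m * dist (entry Φ g (m + 1)) (entry Φ (fun m => g (m + 1)) m) := by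
        refine add_le_add h1 ?_
        rw [entry_def]
        exact h2

/-- **NODE U2's SCALE-SHIFT RATE FROM THE SCHEME (bridge (a) of `T4BetaMemory`, derived).**  If `β` is represented by
the scheme with `ReadLipschitz r cr`, functional memory `StepMemory Φ M′` fading as `FadingMemory C′ ω M′`, one-step
sources `StepShift Φ γ src` with `src k ≤ aρ^k`, and the SMALLNESS `(1 + C′)ω < ρ`, then
`T4CouplingMatching.ScaleShiftRate (cr · a(ρ−ω)(ρ−(1+C′)ω)⁻¹) ρ γ β` — NE4's shape for this family, constant K-uniform.
Bookkeeping: `dataRenewal_sh` + `T4BetaMemory.renewal_geometric` + `extd_tail`.  Every input is UNPRINTED (cell NE2/NE3/NE5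
for `src`, the memory modulus and its threshold for `M′`). [cite: King1986, Thm 3.4 (3.9) p. 656] -/
theorem scaleShiftRate_of_scheme {Φ : ℕ → ℝ → (ℕ → X) → X} {r : X → ℝ} {β : HBeta} {M' : ℕ → ℕ → ℝ}
    {src : ℕ → ℝ} {C' ω γ cr a ρ : ℝ} (hC' : 0 ≤ C') (hω : 0 ≤ ω) (hcr : 0 ≤ cr) (ha : 0 ≤ a)
    (hsmall : (1 + C') * ω < ρ)
    (hrep : Represents Φ r γ β) (hr : ReadLipschitz r cr)
    (hmem : StepMemory Φ M') (hM' : FadingMemory C' ω M') (hsh : StepShift Φ γ src)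
    (hsrc : ∀ k, src k ≤ a * ρ ^ k) :
    ScaleShiftRate (cr * (a * (ρ - ω) / (ρ - (1 + C') * ω))) ρ γ β := by
  intro k w hw
  have hadm : Adm γ (extd w) := extd_adm hw
  have hs : ∀ j, sh Φ (extd w) j ≤ a * (ρ - ω) / (ρ - (1 + C') * ω) * ρ ^ j :=
    T4BetaMemory.renewal_geometric ha hC' hω hsmall (fun j i hij => hM' j i hij.le)
      (fun j => (dataRenewal_sh hmem hsh hadm j).trans (add_le_add (hsrc j) le_rfl))
  rw [hrep (k + 1) w hw, hrep k (Fin.tail w) (tail_mem_box hw), extd_tail]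
  calc |r (entry Φ (extd w) (k + 1)) - r (entry Φ (fun m => extd w (m + 1)) k)|
      ≤ cr * dist (entry Φ (extd w) (k + 1)) (entry Φ (fun m => extd w (m + 1)) k) := hr _ _
    _ ≤ cr * (a * (ρ - ω) / (ρ - (1 + C') * ω) * ρ ^ k) := mul_le_mul_of_nonneg_left (hs k) hcr
    _ = cr * (a * (ρ - ω) / (ρ - (1 + C') * ω)) * ρ ^ k := by ring

/-- **NE4 FOR A β-FAMILY GENERATED BY A ONE-STEP SCHEME — node U2's three inputs with ONE rate.**  Under the four
one-step shapes (direct modulus `ℓ′`, functional memory fading as `C′ω^{age}`, one-step sources `≤ aρ^k`, read-out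
constant `cr`) and the smallness `(1 + C′)ω < ρ`:  `ScaleShiftRate c ρ γ β`, `HistLipschitz Λ γ β` and
`FadingMemory (cr ℓ′) ρ Λ` with `c = cr·a(ρ−ω)(ρ−(1+C′)ω)⁻¹`, `Λ k i = cr ℓ′((1 + C′)ω)^{k−i}` — exactly the hypotheses
`hS`, `hL`, `hΛ` of `T4CouplingMatching.disc_le_of_fadingMemory` / `injectedRate_of_runs(_eventual)`.  HYPOTHESES ONLY
about the scheme; nothing of [Balaban1987RG1] is asserted. [cite: Balaban1987RG1, (0.23) p.256 and (2.13) p.268] -/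
theorem ne4_of_scheme {Φ : ℕ → ℝ → (ℕ → X) → X} {r : X → ℝ} {β : HBeta} {M' : ℕ → ℕ → ℝ}
    {src : ℕ → ℝ} {ℓ' C' ω γ cr a ρ : ℝ} (hℓ' : 0 ≤ ℓ') (hC' : 0 ≤ C') (hω : 0 ≤ ω) (hcr : 0 ≤ cr)
    (ha : 0 ≤ a) (hsmall : (1 + C') * ω < ρ)
    (hrep : Represents Φ r γ β) (hr : ReadLipschitz r cr) (hdir : StepDirect Φ ℓ' γ)
    (hmem : StepMemory Φ M') (hM' : FadingMemory C' ω M') (hsh : StepShift Φ γ src)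
    (hsrc : ∀ k, src k ≤ a * ρ ^ k) :
    ScaleShiftRate (cr * (a * (ρ - ω) / (ρ - (1 + C') * ω))) ρ γ β ∧
    HistLipschitz (fun k i => cr * ℓ' * ((1 + C') * ω) ^ (k - i)) γ β ∧
    FadingMemory (cr * ℓ') ρ (fun k i => cr * ℓ' * ((1 + C') * ω) ^ (k - i)) :=
  ⟨scaleShiftRate_of_scheme hC' hω hcr ha hsmall hrep hr hmem hM' hsh hsrc,
   histLipschitz_of_scheme hℓ' hC' hω hcr hrep hr hdir hmem hM',
   fadingMemory_mono (mul_nonneg hcr hℓ') (mul_nonneg (by linarith) hω) hsmall.le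
     (fadingMemory_profile (mul_nonneg hcr hℓ') (mul_nonneg (by linarith) hω))⟩

/-- **NODE U2's OUTPUT FOR A β-FAMILY GENERATED BY A ONE-STEP SCHEME (composition with the spine's consumer
`T4CouplingMatching.injectedRate_of_runs_eventual`; eventual-AF form).**  For a family of IR-pinned runs `g K` of the
PRINTED recursion (0.20) (`RGEqH`, hypotheses), couplings in ]0,γ], an eventual lower bound `b ≤ β` from scale `k₀` on
(β sub-cell, hypothesis), a β-family generated by a scheme with the four one-step shapes, the smallness
`(1 + C′)ω < ρ < 1` of the memory and the smallness `cr ℓ′((k₀+1)γ³ + 2γ/b) ≤ (1 − ρ)/2` of the history feedback: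
`T4CauchySum.InjectedRate (2c/(1−ρ)) 0 ρ (fun K j ↦ disc (g K) (g (K+1)) j)` with `c = cr·a(ρ−ω)(ρ−(1+C′)ω)⁻¹`.
Bookkeeping over UNPRINTED inputs; NOT summit progress. [cite: Balaban1987RG1, (0.20) p.256 and Thm 2 p.259] -/
theorem injectedRate_of_scheme {Φ : ℕ → ℝ → (ℕ → X) → X} {r : X → ℝ} {β : HBeta} {M' : ℕ → ℕ → ℝ}
    {src : ℕ → ℝ} {ℓ' C' ω γ cr a ρ b : ℝ} {k₀ : ℕ} (g : ℕ → ℕ → ℝ) (gIR : ℝ)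
    (hγ : 0 < γ) (hb : 0 < b) (hρ1 : ρ < 1)
    (hℓ' : 0 ≤ ℓ') (hC' : 0 ≤ C') (hω : 0 ≤ ω) (hcr : 0 ≤ cr) (ha : 0 ≤ a) (hsmall : (1 + C') * ω < ρ)
    (hrep : Represents Φ r γ β) (hr : ReadLipschitz r cr) (hdir : StepDirect Φ ℓ' γ)
    (hmem : StepMemory Φ M') (hM' : FadingMemory C' ω M') (hsh : StepShift Φ γ src)
    (hsrc : ∀ k, src k ≤ a * ρ ^ k)
    (hrun : ∀ K, RGEqH K β (g K)) (hbox : ∀ K i, i ≤ K → 0 < g K i ∧ g K i ≤ γ)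
    (hpin : ∀ K, g K K = gIR) (hlo : EventualLowerH b γ k₀ β)
    (hsmall₂ : cr * ℓ' * (((k₀ : ℝ) + 1) * γ ^ 3 + 2 * γ / b) ≤ (1 - ρ) / 2) :
    T4CauchySum.InjectedRate (2 * (cr * (a * (ρ - ω) / (ρ - (1 + C') * ω))) / (1 - ρ)) 0 ρ
      (fun K j => disc (g K) (g (K + 1)) j) := by
  obtain ⟨hS, hL, hΛ⟩ := ne4_of_scheme hℓ' hC' hω hcr ha hsmall hrep hr hdir hmem hM' hsh hsrc
  have hν0 : 0 ≤ (1 + C') * ω := mul_nonneg (by linarith) hω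
  have hρ0 : 0 < ρ := lt_of_le_of_lt hν0 hsmall
  have hωρ : ω < ρ := by nlinarith
  have hc : 0 ≤ cr * (a * (ρ - ω) / (ρ - (1 + C') * ω)) :=
    mul_nonneg hcr (div_nonneg (mul_nonneg ha (sub_pos.mpr hωρ).le) (sub_pos.mpr hsmall).le)
  exact T4CouplingMatching.injectedRate_of_runs_eventual g gIR hγ hb hρ0 hρ1 hc (mul_nonneg hcr hℓ')
    hrun hbox hpin hS hL hΛ hlo hsmall₂

/-- The β¹-half: `T4CouplingMatching.RemainderShiftRate S c θ γ` IS `ScaleShiftRate c θ γ S.β1` for the remainder family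
`S.β1 : HBeta` of the printed one-loop split ([Balaban1987RG1] (2.12)–(2.14) p. 268; tree `B12Beta.OneLoopSplit`) —
definitionally; so `scaleShiftRate_of_scheme` / `ne4_of_scheme` apply verbatim to a scheme REPRESENTING the remainder
(`Represents Φ r γ S.β1`), which is how the cell splits NE4 (`scaleShiftRate_of_split`). [cite: Balaban1987RG1, (2.12)-(2.14) p.268] -/
theorem remainderShiftRate_iff {β : HBeta} (S : B12Beta.OneLoopSplit β) (c θ γ : ℝ) :
    RemainderShiftRate S c θ γ ↔ ScaleShiftRate c θ γ S.β1 := Iff.rfl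

/-- History moduli pass from the remainder `β¹` to the full `β = β⁰ + β¹`: the printed one-loop part `β⁰_{k+1}` is a
NUMBER per scale (tree `B12Beta.OneLoopSplit.β0 : ℕ → ℝ`, [Balaban1987RG1] (1.6) p. 261 / (2.14) p. 268), so it cancels in
every two-history difference. [cite: Balaban1987RG1, (2.12)-(2.14) p.268] -/
theorem histLipschitz_of_split {β : HBeta} (S : B12Beta.OneLoopSplit β) {Λ : ℕ → ℕ → ℝ} {γ : ℝ}
    (h : HistLipschitz Λ γ S.β1) : HistLipschitz Λ γ β := by
  intro k p q hp hq
  rw [S.split k p, S.split k q, add_sub_add_left_eq_sub]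
  exact h k p q hp hq

/-- **NE4 IN THE CELL'S SPLIT FORM: β⁰-half from the β sub-cell, β¹-half from a one-step scheme.**  Given the printed
one-loop split `S` of `β` ([Balaban1987RG1] (2.12)–(2.14) p. 268), a geometric convergence `|β⁰_{k+1} − β_∞| ≤ c₀ρ^k` of
the coupling-free part ((AF-0r): the β sub-cell's deliverable, UNPRINTED in [I] — "We will investigate other properties
in a separate paper", p. 264), and a one-step scheme REPRESENTING THE REMAINDER `β¹` with the four shapes of §2 and the
smallness `(1 + C′)ω < ρ ≤ 1`: node U2's three inputs for the FULL β — `ScaleShiftRate (2c₀ + cr·a(ρ−ω)(ρ−(1+C′)ω)⁻¹) ρ γ β`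
(via `T4CouplingMatching.scaleShiftRate_of_split`), `HistLipschitz Λ γ β`, `FadingMemory (cr ℓ′) ρ Λ` with
`Λ k i = cr ℓ′((1 + C′)ω)^{k−i}`.  Bookkeeping over UNPRINTED inputs; nothing of [Balaban1987RG1] is asserted.
[cite: Balaban1987RG1, (2.12)-(2.14) p.268 and §1 p.264] -/
theorem ne4_of_split_scheme {β : HBeta} (S : B12Beta.OneLoopSplit β) {Φ : ℕ → ℝ → (ℕ → X) → X} {r : X → ℝ}
    {M' : ℕ → ℕ → ℝ} {src : ℕ → ℝ} {ℓ' C' ω γ cr a ρ binf c₀ : ℝ}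
    (hℓ' : 0 ≤ ℓ') (hC' : 0 ≤ C') (hω : 0 ≤ ω) (hcr : 0 ≤ cr) (ha : 0 ≤ a) (hc₀ : 0 ≤ c₀)
    (hsmall : (1 + C') * ω < ρ) (hρ1 : ρ ≤ 1)
    (hconv : ∀ k, |S.β0 k - binf| ≤ c₀ * ρ ^ k)
    (hrep : Represents Φ r γ S.β1) (hr : ReadLipschitz r cr) (hdir : StepDirect Φ ℓ' γ)
    (hmem : StepMemory Φ M') (hM' : FadingMemory C' ω M') (hsh : StepShift Φ γ src)
    (hsrc : ∀ k, src k ≤ a * ρ ^ k) :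
    ScaleShiftRate (2 * c₀ + cr * (a * (ρ - ω) / (ρ - (1 + C') * ω))) ρ γ β ∧
    HistLipschitz (fun k i => cr * ℓ' * ((1 + C') * ω) ^ (k - i)) γ β ∧
    FadingMemory (cr * ℓ') ρ (fun k i => cr * ℓ' * ((1 + C') * ω) ^ (k - i)) := by
  obtain ⟨hS1, hL1, hΛ⟩ := ne4_of_scheme hℓ' hC' hω hcr ha hsmall hrep hr hdir hmem hM' hsh hsrc
  have hρ0 : 0 ≤ ρ := (mul_nonneg (by linarith) hω).trans hsmall.le
  exact ⟨T4CouplingMatching.scaleShiftRate_of_split S hρ0 hρ1 hc₀ hconv ((remainderShiftRate_iff S _ _ _).mpr hS1),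
    histLipschitz_of_split S hL1, hΛ⟩

end Kernel

/-! ## §4 The threshold in print's currency (located; [analysis] on the formulas of [II] cited in the header) -/

/-- In `FadingMemory C′ ω M′`'s convention with the activity-level age weight of [II] (`ω = L⁻¹` per age unit, the most
recent old entry weighted `C′ω = κ`, i.e. `C′ = Lκ`): the sharp rate is `(1 + C′)ω = L⁻¹ + κ`.  [analysis; cell GAPS
G-t4-U2R2-6a] [cite: Balaban1988RG2Cluster, Lemma 1 (1.33) p.9 and Lemma 3 (2.38) p.20] -/
theorem sharpRate_currency {L κ : ℝ} (hL : 0 < L) : (1 + L * κ) * L⁻¹ = L⁻¹ + κ := by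
  rw [add_mul, one_mul, mul_comm L κ, mul_assoc, mul_inv_cancel₀ hL.ne', mul_one]

/-- … so the smallness `(1 + C′)ω < ρ` of `T4BetaMemory.renewal_geometric` / `scaleShiftRate_of_scheme` reads
`κ < ρ − L⁻¹`: a WINDOW CONDITION on the one-hop transfer constant κ (print's type `κ = c′K₁ε₁`: a condition on ε₁ of the
same currency as [II] p. 21 «O(1)C₃ε₁ ≤ ½E₀», cell cross-read `t4/T4-XREAD-U2R2.md` (Q21)), never "L large" — `L`
is a fixed integer chosen before ε₁.
[analysis; GAPS G-t4-U2R2-6a] [cite: Balaban1988RG2Cluster, (2.41) p.21] -/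
theorem hsmall_currency {L κ ρ : ℝ} (hL : 0 < L) : (1 + L * κ) * L⁻¹ < ρ ↔ κ < ρ - L⁻¹ := by
  rw [sharpRate_currency hL]
  constructor <;> intro h <;> linarith

/-- PRINT'S WINDOW VERSUS THE THRESHOLD.  With `κ = c′x`, `x = K₁ε₁` ranging over print's window `0 ≤ x ≤ ½` and
`c′ ≥ 0` the UNPRINTED absolute factor: a rate `< 1` (`κ < 1 − L⁻¹`) holds throughout the window iff
`c′ < 2(1 − L⁻¹)`; otherwise a smaller ε₁-window of the same currency is needed ([II] p. 21: «this assumption is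
unessential, because the constant C₃ε₁ is small anyway», cell cross-read (Q21)).  Nothing printed fixes `c′` (GAPS G-b12g8-2, G-t4-U2R2-6a).
[analysis] [cite: Balaban1988RG2Cluster, (2.41) p.21] -/
theorem window_currency {L c' : ℝ} (hc' : 0 ≤ c') :
    (∀ x : ℝ, 0 ≤ x → x ≤ 1 / 2 → c' * x < 1 - L⁻¹) ↔ c' < 2 * (1 - L⁻¹) := by
  constructor
  · intro h
    have := h (1 / 2) (by norm_num) le_rfl
    linarith
  · intro h x _ hx
    calc c' * x ≤ c' * (1 / 2) := mul_le_mul_of_nonneg_left hx hc'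
      _ < 1 - L⁻¹ := by linarith

/-! ## §5 Witness: the linear scheme on `ℝ` — every hypothesis with non-zero memory, and the one-step source of the
scale shift is exactly the age-weighted unpartnered oldest entry -/

section Witness

/-- The LINEAR SCHEME on `X = ℝ`: new entry = `ℓ′·(own coupling) + Σ_{m<j} C′ω^{j−m}·(entry born at m)` — a caricature
with exactly the memory profile `C′ω^{age}` of `FadingMemory`, used only to show the shapes of §2 are jointly satisfiable
with genuinely non-zero memory. [folklore] -/
def linStep (ℓ' C' ω : ℝ) : ℕ → ℝ → (ℕ → ℝ) → ℝ :=
  fun j g y => ℓ' * g + ∑ m ∈ range j, C' * ω ^ (j - m) * y m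

/-- The linear scheme has direct modulus `ℓ′` (`ℓ′ ≥ 0`; any γ). [folklore] -/
theorem linStep_direct {ℓ' C' ω γ : ℝ} (hℓ' : 0 ≤ ℓ') : StepDirect (linStep ℓ' C' ω) ℓ' γ := by
  intro j g g' y _ _ _ _
  simp only [linStep, Real.dist_eq]
  rw [show ℓ' * g + ∑ m ∈ range j, C' * ω ^ (j - m) * y m - (ℓ' * g' + ∑ m ∈ range j, C' * ω ^ (j - m) * y m)
      = ℓ' * (g - g') by ring, abs_mul, abs_of_nonneg hℓ']

/-- The linear scheme has functional memory `M′ j m = C′ω^{j−m}` (`C′, ω ≥ 0`). [folklore] -/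
theorem linStep_memory {ℓ' C' ω : ℝ} (hC' : 0 ≤ C') (hω : 0 ≤ ω) :
    StepMemory (linStep ℓ' C' ω) (fun j m => C' * ω ^ (j - m)) := by
  intro j g y y'
  simp only [linStep, Real.dist_eq]
  rw [show ℓ' * g + ∑ m ∈ range j, C' * ω ^ (j - m) * y m - (ℓ' * g + ∑ m ∈ range j, C' * ω ^ (j - m) * y' m)
      = ∑ m ∈ range j, C' * ω ^ (j - m) * (y m - y' m) by
    rw [add_sub_add_left_eq_sub, ← Finset.sum_sub_distrib]
    exact Finset.sum_congr rfl fun m _ => by ring]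
  refine (Finset.abs_sum_le_sum_abs _ _).trans (le_of_eq ?_)
  refine Finset.sum_congr rfl fun m _ => ?_
  rw [abs_mul, abs_of_nonneg (mul_nonneg hC' (pow_nonneg hω _))]

/-- … which is `FadingMemory C′ ω` (with equality). [folklore] -/
theorem linStep_fading {C' ω : ℝ} (hC' : 0 ≤ C') (hω : 0 ≤ ω) :
    FadingMemory C' ω (fun j m => C' * ω ^ (j - m)) := fun _ _ _ =>
  ⟨mul_nonneg hC' (pow_nonneg hω _), le_rfl⟩

/-- THE ONE-STEP SOURCE OF THE LINEAR SCHEME IS EXACTLY THE AGE-WEIGHTED UNPARTNERED OLDEST ENTRY: run B's entry born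
at step k + 1 minus what the step-k map makes of run B's shifted flag at the same coupling equals
`C′ω^{k+1} · entry 0` — every partnered entry cancels (`Finset.sum_range_succ'`), only the finest, unpartnered one
survives, with the weight of its age k + 1.  The words of `T4BetaMemory.ShiftDecomposition` ("run B's unpartnered finest
bracket weighted by its age") made kernel in the caricature; in a realistic scheme the maps themselves also depend on the
step (cell NE2/NE3), which the caricature does not model. [folklore] -/
theorem linStep_shift_eq (ℓ' C' ω : ℝ) (g : ℕ → ℝ) (k : ℕ) :
    entry (linStep ℓ' C' ω) g (k + 1)
      - linStep ℓ' C' ω k (g (k + 1)) (fun m => if m < k then entry (linStep ℓ' C' ω) g (m + 1) else default)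
      = C' * ω ^ (k + 1) * entry (linStep ℓ' C' ω) g 0 := by
  rw [entry_def]
  simp only [linStep]
  have hflag : ∑ m ∈ range (k + 1), C' * ω ^ (k + 1 - m) * flag (linStep ℓ' C' ω) g (k + 1) m
      = ∑ m ∈ range (k + 1), C' * ω ^ (k + 1 - m) * entry (linStep ℓ' C' ω) g m := by
    refine Finset.sum_congr rfl fun m hm => ?_
    rw [flag_apply, if_pos (mem_range.mp hm)]
  have hsh : ∑ m ∈ range k, C' * ω ^ (k - m) * (if m < k then entry (linStep ℓ' C' ω) g (m + 1) else default)
      = ∑ m ∈ range k, C' * ω ^ (k + 1 - (m + 1)) * entry (linStep ℓ' C' ω) g (m + 1) := by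
    refine Finset.sum_congr rfl fun m hm => ?_
    rw [if_pos (mem_range.mp hm), show k + 1 - (m + 1) = k - m by omega]
  -- `linStep` is unfolded by `simp only` above only at the head; restate with the helper equalities
  change ℓ' * g (k + 1) + ∑ m ∈ range (k + 1), C' * ω ^ (k + 1 - m) * flag (linStep ℓ' C' ω) g (k + 1) m
      - (ℓ' * g (k + 1)
          + ∑ m ∈ range k, C' * ω ^ (k - m) * (if m < k then entry (linStep ℓ' C' ω) g (m + 1) else default))
      = C' * ω ^ (k + 1) * entry (linStep ℓ' C' ω) g 0
  rw [hflag, hsh, Finset.sum_range_succ' (fun m => C' * ω ^ (k + 1 - m) * entry (linStep ℓ' C' ω) g m)]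
  simp only [Nat.sub_zero]
  ring

/-- Hence the linear scheme satisfies `StepShift` with the geometric source `src k = (C′ℓ′γω)·ω^k` along admissible
sequences (`|entry 0| = ℓ′g₀ ≤ ℓ′γ`; `ℓ′, C′, ω ≥ 0`). [folklore] -/
theorem linStep_shift {ℓ' C' ω γ : ℝ} (hℓ' : 0 ≤ ℓ') (hC' : 0 ≤ C') (hω : 0 ≤ ω) :
    StepShift (linStep ℓ' C' ω) γ (fun k => C' * ℓ' * γ * ω * ω ^ k) := by
  intro g hg k
  rw [Real.dist_eq, linStep_shift_eq]
  have h0 : entry (linStep ℓ' C' ω) g 0 = ℓ' * g 0 := by simp [entry_def, linStep]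
  rw [h0, abs_of_nonneg (mul_nonneg (mul_nonneg hC' (pow_nonneg hω _)) (mul_nonneg hℓ' (hg 0).1.le))]
  have h1 : ℓ' * g 0 ≤ ℓ' * γ := mul_le_mul_of_nonneg_left (hg 0).2 hℓ'
  calc C' * ω ^ (k + 1) * (ℓ' * g 0) ≤ C' * ω ^ (k + 1) * (ℓ' * γ) :=
        mul_le_mul_of_nonneg_left h1 (mul_nonneg hC' (pow_nonneg hω _))
    _ = C' * ℓ' * γ * ω * ω ^ k := by rw [pow_succ]; ring

/-- The identity read-out is 1-Lipschitz. [folklore] -/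
theorem readLipschitz_id : ReadLipschitz (fun x : ℝ => x) 1 := fun x x' => by
  rw [one_mul, Real.dist_eq]

/-- NON-VACUITY OF §3 WITH NON-ZERO MEMORY: the β-family READ OFF the linear scheme,
`βlin k v = entry (linStep ℓ′ C′ ω) (extd v) k`, satisfies node U2's three inputs with the constants of `ne4_of_scheme`
(`cr = 1`, `a = C′ℓ′γω`) as soon as `(1 + C′)ω < ρ` (`ℓ′, C′, ω ≥ 0`, `γ ≥ 0`). [folklore] -/
theorem ne4_linStep {ℓ' C' ω γ ρ : ℝ} (hℓ' : 0 ≤ ℓ') (hC' : 0 ≤ C') (hω : 0 ≤ ω) (hγ : 0 ≤ γ)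
    (hsmall : (1 + C') * ω < ρ) :
    ScaleShiftRate (1 * (C' * ℓ' * γ * ω * (ρ - ω) / (ρ - (1 + C') * ω))) ρ γ
        (fun k v => entry (linStep ℓ' C' ω) (extd v) k) ∧
    HistLipschitz (fun k i => 1 * ℓ' * ((1 + C') * ω) ^ (k - i)) γ
        (fun k v => entry (linStep ℓ' C' ω) (extd v) k) ∧
    FadingMemory (1 * ℓ') ρ (fun k i => 1 * ℓ' * ((1 + C') * ω) ^ (k - i)) := by
  have hων : ω ≤ (1 + C') * ω := by nlinarith
  have hωρ : ω ≤ ρ := (hων.trans hsmall.le)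
  refine ne4_of_scheme (r := fun x : ℝ => x) (src := fun k => C' * ℓ' * γ * ω * ω ^ k) hℓ' hC' hω zero_le_one
    (mul_nonneg (mul_nonneg (mul_nonneg hC' hℓ') hγ) hω) hsmall (fun k v _ => rfl) readLipschitz_id
    (linStep_direct hℓ') (linStep_memory hC' hω) (linStep_fading hC' hω) (linStep_shift hℓ' hC' hω) ?_
  intro k
  exact mul_le_mul_of_nonneg_left (pow_le_pow_left₀ hω hωρ k)
    (mul_nonneg (mul_nonneg (mul_nonneg hC' hℓ') hγ) hω)

end Witness

/-! ## §6 Where the memory modulus splits: activity-level insertion (printed structure) ∘ activity → value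
(kernel in kind, `T4ActivityLipschitz`) -/

section Factor

variable {X : Type*} [PseudoMetricSpace X] {A : Type*} [PseudoMetricSpace A]

/-- A FACTORISED one-step scheme: the entry born at step j is the VALUE `val j g` of an expansion whose ACTIVITIES
`act j g y` are built from the coupling and the flag of older entries ([II] (1.33) p. 9: the fluctuation-field action
V′_k(Y, …) assembled from the old terms; (2.13)–(2.14) pp. 14–15: E^{(k+1)}(X) = the connected sum in the activities H(Z)
— loci per cell cross-read `t4/T4-XREAD-U2R2.md` (Q13)–(Q16)).  MODEL of the bookkeeping only.
[cite: Balaban1988RG2Cluster, (1.33) p.9 and (2.13) p.14] -/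
def factorStep (act : ℕ → ℝ → (ℕ → X) → A) (val : ℕ → ℝ → A → X) : ℕ → ℝ → (ℕ → X) → X :=
  fun j g y => val j g (act j g y)

/-- HYPOTHESIS SHAPE (PRINTED STRUCTURE, printed-TYPE constant): ACTIVITY-LEVEL INSERTION WITH AGE FACTOR — at fixed
coupling the step-j activities depend on the entry born at `m < j` with modulus `κA·ω^{j−m}`:
`dist (act j g y) (act j g y′) ≤ Σ_{m<j} κA ω^{j−m} dist (y m) (y′ m)`.  [II] prints the LINEAR dependence of the
fluctuation activities on the old terms ((1.33) p. 9) with one surviving age factor `L^{jη} = L^{−(k−j)}` per old scale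
((1.24) p. 8 «This yields (6L)⁴L^jη, and the sum over j is bounded by 2(6L)⁴»; (1.36) p. 9) — cell certificate C-b12g8-1
(«LINEAR VERBATIM up to the activities»); the passage to the polymer activities H(Z) of (2.14) (an exponential of the
former on a bounded domain) keeps a modulus of the same shape with a printed-TYPE constant; no NUMBER κA is printed.
[cite: Balaban1988RG2Cluster, (1.33)-(1.36) p.9] -/
def ActInsertion (act : ℕ → ℝ → (ℕ → X) → A) (κA ω : ℝ) : Prop :=
  ∀ j (g : ℝ) (y y' : ℕ → X), dist (act j g y) (act j g y') ≤ ∑ m ∈ range j, κA * ω ^ (j - m) * dist (y m) (y' m)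

/-- HYPOTHESIS SHAPE (NOT PRINTED in [II], which bounds ONE activity family, (2.41) p. 21; KERNEL IN KIND in the tree):
ACTIVITY → VALUE LIPSCHITZ — `dist (val j g a) (val j g a′) ≤ KV · dist a a′`.  For Kotecký–Preiss polymer gases in
B13's printed letters this is `T4ActivityLipschitz.norm_locE_sub_locE_le` (cell NE5 prover P2):
`|E_A^{(k+1)}(X) − E_B^{(k+1)}(X)| ≤ 4ε · τc₁K₀e^{−b} e^{−r₁d(X)}` for two activity families under a common (2.38)-majorant,
within relative distance ε, under the DOUBLED-majorant smallness — so with activities measured relative to the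
majorant, `KV = 4·τc₁K₀e^{−b}` (the (2.41) envelope constant times the Cauchy factor 4), valid on the majorant ball
(restricting the shapes of this file to an invariant admissible ball is routine and omitted, as in §2).  Cited BY NAME;
not imported, not instantiated here. [cite: Balaban1988RG2Cluster, (2.39)-(2.41) p.21] -/
def ActToValue (val : ℕ → ℝ → A → X) (KV : ℝ) : Prop :=
  ∀ j (g : ℝ) (a a' : A), dist (val j g a) (val j g a') ≤ KV * dist a a'

/-- **THE MEMORY MODULUS (M) FROM ITS TWO LOCATED HALVES.**  (lin) `ActInsertion act κA ω` + (val) `ActToValue val KV`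
(`KV ≥ 0`) ⇒ `StepMemory (factorStep act val) (fun j m ↦ KV·κA·ω^{j−m})` — the functional memory of §2 with
`C′ = KV·κA`: in print's currency (§4) `κ = C′ω = KV·κA·L⁻¹`, `KV = 4 × (2.41)-envelope constant` (kernel in kind),
κA printed-type.  Composition of two Lipschitz bounds; bookkeeping. [folklore] -/
theorem stepMemory_of_factor {act : ℕ → ℝ → (ℕ → X) → A} {val : ℕ → ℝ → A → X} {κA ω KV : ℝ}
    (hKV : 0 ≤ KV) (hins : ActInsertion act κA ω) (hval : ActToValue val KV) :
    StepMemory (factorStep act val) (fun j m => KV * κA * ω ^ (j - m)) := by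
  intro j g y y'
  show dist (val j g (act j g y)) (val j g (act j g y')) ≤ _
  calc dist (val j g (act j g y)) (val j g (act j g y'))
      ≤ KV * dist (act j g y) (act j g y') := hval j g _ _
    _ ≤ KV * ∑ m ∈ range j, κA * ω ^ (j - m) * dist (y m) (y' m) :=
        mul_le_mul_of_nonneg_left (hins j g y y') hKV
    _ = ∑ m ∈ range j, KV * κA * ω ^ (j - m) * dist (y m) (y' m) := by
        rw [Finset.mul_sum]
        exact Finset.sum_congr rfl fun m _ => by ring

/-- … and that memory is `FadingMemory (KV·κA) ω` (with equality; `KV, κA, ω ≥ 0`). [folklore] -/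
theorem fadingMemory_of_factor {κA ω KV : ℝ} (hKV : 0 ≤ KV) (hκA : 0 ≤ κA) (hω : 0 ≤ ω) :
    FadingMemory (KV * κA) ω (fun j m => KV * κA * ω ^ (j - m)) :=
  fadingMemory_profile (mul_nonneg hKV hκA) hω

/-- The DIRECT modulus of a factorised scheme likewise splits: activities Lipschitz in the own coupling with constant
`ℓA` on ]0,γ] and the value map Lipschitz in its explicit coupling dependence with constant `ℓV` (every term of [I]
(2.12) p. 268 carries `g_kCB`, inside and outside the activities; printed-qualitative, p. 264) and (val) ⇒
`StepDirect (factorStep act val) (ℓV + KV·ℓA) γ`. [folklore] -/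
theorem stepDirect_of_factor {act : ℕ → ℝ → (ℕ → X) → A} {val : ℕ → ℝ → A → X} {ℓA ℓV KV γ : ℝ} (hKV : 0 ≤ KV)
    (hdirA : ∀ j (g g' : ℝ) (y : ℕ → X), 0 < g → g ≤ γ → 0 < g' → g' ≤ γ →
      dist (act j g y) (act j g' y) ≤ ℓA * |g - g'|)
    (hdirV : ∀ j (g g' : ℝ) (a : A), 0 < g → g ≤ γ → 0 < g' → g' ≤ γ →
      dist (val j g a) (val j g' a) ≤ ℓV * |g - g'|)
    (hval : ActToValue val KV) :
    StepDirect (factorStep act val) (ℓV + KV * ℓA) γ := by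
  intro j g g' y hg hgγ hg' hg'γ
  show dist (val j g (act j g y)) (val j g' (act j g' y)) ≤ _
  calc dist (val j g (act j g y)) (val j g' (act j g' y))
      ≤ dist (val j g (act j g y)) (val j g' (act j g y)) + dist (val j g' (act j g y)) (val j g' (act j g' y)) :=
        dist_triangle _ _ _
    _ ≤ ℓV * |g - g'| + KV * (ℓA * |g - g'|) :=
        add_le_add (hdirV j g g' _ hg hgγ hg' hg'γ)
          ((hval j g' _ _).trans (mul_le_mul_of_nonneg_left (hdirA j g g' y hg hgγ hg' hg'γ) hKV))
    _ = (ℓV + KV * ℓA) * |g - g'| := by ring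

end Factor

end Literature.MathematicalPhysics.QuantumFieldTheory.Balaban1983to89.T4FlagMemory
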